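import Summits.CriticalPhenomena.PercolationContinuityZ3.Theorems.PercNearOneGluingNoHeavyQuantFarSunTKDefs
import HarnessLib

/-!
# FAR beyond trees: the certificate `T_K` — the pair weight depends only on SIX STATISTICS (`Fcert = Fc ∘ stats`)

builds on p205010 (kernel theorem, internal audit signed; external expert review pending)

Support file (`--supports stmt-CriticalPhenomena-4575`), seat `prim-cert-1` (gen 23); memo `prim-cert-1/FROM-prim-cert-1-g23-SUNFAR-ALL-K.md` §3(b).
Vocabulary `…QuantFarSunTKDefs`.

* `TK.mem_inner`, `TK.card_inner`, `TK.sum_range_split`, `TK.card_split` — bookkeeping for the end indices `0`, `K − 1` and the interior `TK.inner K`.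
* `TK.aCoef_of_mem_inner`, `TK.aCoef_zero`, `TK.aCoef_last`, `TK.bCoef_eq` — the certificate's coefficients at interior / end indices.
* **`TK.Fcert_eq_Fc`** — for `4 ≤ K` and `V, U ⊆ range K`:
  `Fcert K V U = Fc K |V ∩ inner| |U ∩ inner| |V ∩ U ∩ inner| (0 ∈ V) (K−1 ∈ V) (0 ∈ U) (K−1 ∈ U)`; hence **`TK.Wcert_eq_Wc`**.
  This is what lets the orbit sums be computed at count level (`…QuantFarSunTKOrbit`).
No sorries; standard axioms.  Elementary [this work].
-/

namespace Summit.CriticalPhenomena.PercolationContinuityZ3.Theorems.HairyCycle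

namespace TK

open Finset

variable {K : ℕ}

/-! ## The interior and the two ends -/

/-- Membership in the interior. [this work] -/
theorem mem_inner {k : ℕ} : k ∈ inner K ↔ k < K ∧ k ≠ 0 ∧ k ≠ K - 1 := by
  unfold inner; rw [Finset.mem_filter, Finset.mem_range]

/-- The interior is part of the index range. [this work] -/
theorem inner_subset_range : inner K ⊆ range K := fun _ hk => Finset.mem_range.2 (mem_inner.1 hk).1

/-- `range K = {0, K−1} ∪ inner K` for `2 ≤ K`. [this work] -/
theorem range_eq_insert_inner (hK : 2 ≤ K) : range K = insert 0 (insert (K - 1) (inner K)) := by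
  ext k
  rw [Finset.mem_range, Finset.mem_insert, Finset.mem_insert, mem_inner]
  omega

/-- `|inner K| = K − 2` for `2 ≤ K`. [this work] -/
theorem card_inner (hK : 2 ≤ K) : (inner K).card = K - 2 := by
  have h := Finset.card_range K
  rw [range_eq_insert_inner hK, Finset.card_insert_of_notMem, Finset.card_insert_of_notMem] at h
  · omega
  · rw [mem_inner]; omega
  · rw [Finset.mem_insert, mem_inner]; omega

/-- A sum over `range K` = the two end terms + the interior sum (`2 ≤ K`). [this work] -/
theorem sum_range_split (hK : 2 ≤ K) (f : ℕ → ℤ) : ∑ k ∈ range K, f k = f 0 + f (K - 1) + ∑ k ∈ inner K, f k := by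
  rw [range_eq_insert_inner hK, Finset.sum_insert, Finset.sum_insert]
  · ring
  · rw [mem_inner]; omega
  · rw [Finset.mem_insert, mem_inner]; omega

/-- `|V| = |V ∩ inner| + 𝟙[0 ∈ V] + 𝟙[K−1 ∈ V]` for `V ⊆ range K`, `2 ≤ K`. [this work] -/
theorem card_split (hK : 2 ≤ K) {V : Finset ℕ} (hV : V ⊆ range K) :
    (V.card : ℤ) = (V ∩ inner K).card + (if 0 ∈ V then 1 else 0) + (if K - 1 ∈ V then 1 else 0) := by
  classical
  have hV' : V = (V ∩ inner K) ∪ (V.filter fun k => k = 0 ∨ k = K - 1) := by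
    ext k
    rw [Finset.mem_union, Finset.mem_inter, Finset.mem_filter, mem_inner]
    constructor
    · intro hk
      have := Finset.mem_range.1 (hV hk)
      by_cases h0 : k = 0
      · exact Or.inr ⟨hk, Or.inl h0⟩
      by_cases h1 : k = K - 1
      · exact Or.inr ⟨hk, Or.inr h1⟩
      exact Or.inl ⟨hk, this, h0, h1⟩
    · rintro (⟨hk, -⟩ | ⟨hk, -⟩) <;> exact hk
  have hdisj : Disjoint (V ∩ inner K) (V.filter fun k => k = 0 ∨ k = K - 1) := by
    rw [Finset.disjoint_left]
    intro k hk hk'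
    rw [Finset.mem_inter, mem_inner] at hk
    rw [Finset.mem_filter] at hk'
    omega
  have hcard := Finset.card_union_of_disjoint hdisj
  rw [← hV'] at hcard
  -- the end part has `𝟙[0 ∈ V] + 𝟙[K−1 ∈ V]` elements
  have hends : ((V.filter fun k => k = 0 ∨ k = K - 1).card : ℤ) = (if 0 ∈ V then 1 else 0) + (if K - 1 ∈ V then 1 else 0) := by
    have hset : (V.filter fun k => k = 0 ∨ k = K - 1) = (V.filter fun k => k = 0) ∪ (V.filter fun k => k = K - 1) := by
      ext k; rw [Finset.mem_union, Finset.mem_filter, Finset.mem_filter, Finset.mem_filter]; tauto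
    have hd : Disjoint (V.filter fun k => k = 0) (V.filter fun k => k = K - 1) := by
      rw [Finset.disjoint_left]; intro k hk hk'
      rw [Finset.mem_filter] at hk hk'; omega
    rw [hset, Finset.card_union_of_disjoint hd]
    have h0 : (V.filter fun k => k = 0).card = if 0 ∈ V then 1 else 0 := by
      by_cases h : 0 ∈ V
      · rw [if_pos h, Finset.card_eq_one]
        refine ⟨0, ?_⟩
        ext k; rw [Finset.mem_filter, Finset.mem_singleton]
        exact ⟨fun hk => hk.2, fun hk => ⟨hk ▸ h, hk⟩⟩
      · rw [if_neg h, Finset.card_eq_zero, Finset.filter_eq_empty_iff]; intro k hk hk0; subst hk0; exact h hk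
    have h1 : (V.filter fun k => k = K - 1).card = if K - 1 ∈ V then 1 else 0 := by
      by_cases h : K - 1 ∈ V
      · rw [if_pos h, Finset.card_eq_one]
        refine ⟨K - 1, ?_⟩
        ext k; rw [Finset.mem_filter, Finset.mem_singleton]
        exact ⟨fun hk => hk.2, fun hk => ⟨hk ▸ h, hk⟩⟩
      · rw [if_neg h, Finset.card_eq_zero, Finset.filter_eq_empty_iff]; intro k hk hk0; subst hk0; exact h hk
    rw [h0, h1]; push_cast; split_ifs <;> simp
  rw [hcard]; push_cast; rw [hends]; ring

/-! ## The coefficients at interior and end indices -/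

open scoped Classical in
/-- `a_k(U)` at an interior index. [this work] -/
theorem aCoef_of_mem_inner {k : ℕ} (hk : k ∈ inner K) (U : Finset ℕ) :
    aCoef K k U = if U.card = 0 then 2 else if U.card = 1 then 1 else if k ∈ U then (K : ℤ) - U.card else 0 := by
  have h := mem_inner.1 hk
  unfold aCoef
  rw [if_neg (by omega)]

open scoped Classical in
/-- `a_0(U)` (end index `0`). [this work] -/
theorem aCoef_zero (U : Finset ℕ) :
    aCoef K 0 U = if (U.card = 1 ∧ 0 ∉ U) ∨ (U.card = 2 ∧ 0 ∈ U) then (K : ℤ) - 2 else 0 := by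
  unfold aCoef; rw [if_pos (Or.inl rfl)]

open scoped Classical in
/-- `a_{K−1}(U)` (end index `K − 1`). [this work] -/
theorem aCoef_last (U : Finset ℕ) :
    aCoef K (K - 1) U = if (U.card = 1 ∧ K - 1 ∉ U) ∨ (U.card = 2 ∧ K - 1 ∈ U) then (K : ℤ) - 2 else 0 := by
  unfold aCoef; rw [if_pos (Or.inr rfl)]

open scoped Classical in
/-- `b(U) = 𝟙[|U| = 1 ∧ 0 ∉ U ∧ K−1 ∉ U]`. [this work] -/
theorem bCoef_eq (U : Finset ℕ) : bCoef K U = if U.card = 1 ∧ 0 ∉ U ∧ K - 1 ∉ U then 1 else 0 := by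
  unfold bCoef
  by_cases h1 : U.card = 1
  · obtain ⟨w, rfl⟩ := Finset.card_eq_one.1 h1
    simp only [Finset.card_singleton, true_and, Finset.mem_singleton, forall_eq]
    by_cases hw0 : w = 0
    · subst hw0; simp
    by_cases hwK : w = K - 1
    · subst hwK; simp [hw0]
    · rw [if_pos ⟨hw0, hwK⟩, if_pos ⟨Ne.symm hw0, Ne.symm hwK⟩]
  · rw [if_neg (fun h => h1 h.1), if_neg (fun h => h1 h.1)]

/-! ## Indicator sums -/

open scoped Classical in
/-- `Σ_{k ∈ S} 𝟙[k ∉ V] = |S| − |S ∩ V|`. [this work] -/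
theorem sum_ite_notMem (S V : Finset ℕ) : ∑ k ∈ S, (if k ∉ V then (1 : ℤ) else 0) = S.card - (S ∩ V).card := by
  have h1 : ∑ k ∈ S, (if k ∉ V then (1 : ℤ) else 0) = ((S.filter fun k => k ∉ V).card : ℤ) := by
    rw [← Finset.sum_filter]; simp
  have h2 : (S.filter fun k => k ∉ V) = S \ V := by
    ext k; rw [Finset.mem_filter, Finset.mem_sdiff]
  rw [h1, h2]
  have := Finset.card_sdiff_add_card_inter S V
  omega

open scoped Classical in
/-- `Σ_{k ∈ S} 𝟙[k ∈ U]·c·g k = c · Σ_{k ∈ S ∩ U} g k`. [this work] -/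
theorem sum_ite_mem_mul (S U : Finset ℕ) (c : ℤ) (g : ℕ → ℤ) :
    ∑ k ∈ S, (if k ∈ U then c else 0) * g k = c * ∑ k ∈ S ∩ U, g k := by
  have h1 : ∑ k ∈ S, (if k ∈ U then c else 0) * g k = ∑ k ∈ S, (if k ∈ U then c * g k else 0) :=
    Finset.sum_congr rfl fun k _ => by rw [ite_mul, zero_mul]
  rw [h1, Finset.sum_ite_mem, Finset.mul_sum]

/-! ## The statistics theorem -/

set_option maxHeartbeats 4000000 in
set_option linter.unusedSimpArgs false in
/-- **`F(V;U)` depends only on the six statistics**: for `4 ≤ K` and `V, U ⊆ range K`,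
`Fcert K V U = Fc K |V∩inner| |U∩inner| |V∩U∩inner| (0∈V) (K−1∈V) (0∈U) (K−1∈U)`. [this work] -/
theorem Fcert_eq_Fc (hK : 4 ≤ K) {V U : Finset ℕ} (hV : V ⊆ range K) (hU : U ⊆ range K) :
    Fcert K V U = Fc K (V ∩ inner K).card (U ∩ inner K).card (V ∩ U ∩ inner K).card
      (decide (0 ∈ V)) (decide (K - 1 ∈ V)) (decide (0 ∈ U)) (decide (K - 1 ∈ U)) := by
  classical
  -- names for the statistics
  have hcV := card_split (by omega) hV
  have hcU := card_split (by omega) hU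
  have hinn : ((inner K).card : ℤ) = (K : ℤ) - 2 := by rw [card_inner (by omega)]; omega
  -- the interior part of the sum
  set low : ℤ := if V.card ≤ 1 then 1 else 0 with hlow
  have hXsum : ∑ k ∈ inner K, aCoef K k U * ((if k ∉ V then 1 else 0) - low) =
      (if U.card = 0 then 2 * (((K : ℤ) - 2 - (V ∩ inner K).card) - ((K : ℤ) - 2) * low)
       else if U.card = 1 then (((K : ℤ) - 2 - (V ∩ inner K).card) - ((K : ℤ) - 2) * low)
       else ((K : ℤ) - U.card) * ((((U ∩ inner K).card : ℤ) - (V ∩ U ∩ inner K).card) - ((U ∩ inner K).card : ℤ) * low)) := by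
    have hS : ∑ k ∈ inner K, ((if k ∉ V then (1 : ℤ) else 0) - low) = ((K : ℤ) - 2 - (V ∩ inner K).card) - ((K : ℤ) - 2) * low := by
      rw [Finset.sum_sub_distrib, sum_ite_notMem, Finset.sum_const, Finset.inter_comm, hinn, nsmul_eq_mul, hinn]
    by_cases hU0 : U.card = 0
    · rw [if_pos hU0]
      have : ∑ k ∈ inner K, aCoef K k U * ((if k ∉ V then 1 else 0) - low) = ∑ k ∈ inner K, 2 * ((if k ∉ V then (1 : ℤ) else 0) - low) :=
        Finset.sum_congr rfl fun k hk => by rw [aCoef_of_mem_inner hk, if_pos hU0]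
      rw [this, ← Finset.mul_sum, hS]
    rw [if_neg hU0]
    by_cases hU1 : U.card = 1
    · rw [if_pos hU1]
      have : ∑ k ∈ inner K, aCoef K k U * ((if k ∉ V then 1 else 0) - low) = ∑ k ∈ inner K, ((if k ∉ V then (1 : ℤ) else 0) - low) :=
        Finset.sum_congr rfl fun k hk => by rw [aCoef_of_mem_inner hk, if_neg hU0, if_pos hU1, one_mul]
      rw [this, hS]
    rw [if_neg hU1]
    have : ∑ k ∈ inner K, aCoef K k U * ((if k ∉ V then 1 else 0) - low) =
        ∑ k ∈ inner K, (if k ∈ U then ((K : ℤ) - U.card) else 0) * ((if k ∉ V then (1 : ℤ) else 0) - low) :=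
      Finset.sum_congr rfl fun k hk => by rw [aCoef_of_mem_inner hk, if_neg hU0, if_neg hU1]
    have h3 : (inner K ∩ U) ∩ V = V ∩ U ∩ inner K := by ext k; simp only [Finset.mem_inter]; tauto
    rw [this, sum_ite_mem_mul, Finset.sum_sub_distrib, sum_ite_notMem, Finset.sum_const, nsmul_eq_mul, h3,
      Finset.inter_comm (inner K) U]
  -- assemble
  unfold Fcert
  rw [sum_range_split (by omega), hXsum, aCoef_zero, aCoef_last, bCoef_eq, hlow]
  -- now everything is in terms of the statistics; case on the end memberships and the small sizes
  have hiV : (V ∩ U ∩ inner K).card ≤ (V ∩ inner K).card := Finset.card_le_card (by intro k; simp only [Finset.mem_inter]; tauto)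
  have hiU : (V ∩ U ∩ inner K).card ≤ (U ∩ inner K).card := Finset.card_le_card (by intro k; simp only [Finset.mem_inter]; tauto)
  generalize (V ∩ inner K).card = vI at *
  generalize (U ∩ inner K).card = uI at *
  generalize (V ∩ U ∩ inner K).card = iI at *
  have h0K : (0 : ℕ) ≠ K - 1 := by omega
  unfold Fc
  by_cases hv0 : 0 ∈ V <;> by_cases hvK : K - 1 ∈ V <;> by_cases hu0 : 0 ∈ U <;> by_cases huK : K - 1 ∈ U <;>
    simp only [hv0, hvK, hu0, huK, decide_true, decide_false, Bool.toNat_true, Bool.toNat_false,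
      Bool.and_true, Bool.and_false, if_true, if_false, not_true, not_false_iff, and_true, and_false,
      or_false, false_or, Nat.cast_zero, Nat.cast_one, add_zero, zero_add] at hcV hcU ⊢ <;>
    (rcases Nat.lt_or_ge vI 2 with hv | hv <;> [(interval_cases vI); skip]) <;>
    (rcases Nat.lt_or_ge uI 3 with hu | hu <;> [(interval_cases uI); skip]) <;>
    (simp (disch := omega) only [if_pos, if_neg, if_true, if_false, hcV, hcU, Nat.add_eq_zero_iff, Nat.add_eq_one_iff,
      one_ne_zero, zero_ne_one, OfNat.ofNat_ne_zero, OfNat.ofNat_ne_one, OfNat.zero_ne_ofNat, OfNat.one_ne_ofNat, Nat.succ_ne_zero,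
      add_zero, zero_add, and_true, and_false, true_and, false_and, or_false, false_or, true_or, or_true, and_self, or_self,
      Nat.cast_zero, Nat.cast_one, Nat.cast_ofNat, Nat.cast_add, mul_one, mul_zero, one_mul, zero_mul, sub_zero]) <;>
    (first | done | ring1)

/-- **The symmetrised weight at count level**: `Wcert K V U = Wc K …(statistics)`. [this work] -/
theorem Wcert_eq_Wc (hK : 4 ≤ K) {V U : Finset ℕ} (hV : V ⊆ range K) (hU : U ⊆ range K) :
    Wcert K V U = Wc K (V ∩ inner K).card (U ∩ inner K).card (V ∩ U ∩ inner K).card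
      (decide (0 ∈ V)) (decide (K - 1 ∈ V)) (decide (0 ∈ U)) (decide (K - 1 ∈ U)) := by
  unfold Wcert Wc
  rw [Fcert_eq_Fc hK hV hU, Fcert_eq_Fc hK hU hV]
  have h : U ∩ V ∩ inner K = V ∩ U ∩ inner K := by rw [Finset.inter_comm U V]
  rw [h]

end TK

end Summit.CriticalPhenomena.PercolationContinuityZ3.Theorems.HairyCycle
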